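import Summits.HodgeConjecture.HodgeConjecture.Theses.ConservativityLefschetz
import Summits.HodgeConjecture.HodgeConjecture.Theorems.NoetherLefschetzOneUpMiddleReduction

/-!
# Birth skeleton (BC3) of the crux `AbelianComplement` (stmt-HodgeConjecture-10452)

Registrar seat `planner-skel-stmt-HodgeConjecture-10452-0` (mode `skeleton-register`, 2026-08-17).

## The crux, as filed

Item `stmt-HodgeConjecture-10452`, decl (live, by name)
`Summit.HodgeConjecture.HodgeConjecture.Theses.ConservativityLefschetz.AbelianComplement`:

  `(∀ A : AbelianVariety ℂ, IsSmoothProjective A.dim A.X → HodgeConjectureFor A.dim A.X) → HodgeConjecture`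

— the Hodge conjecture for ALL smooth projective complex varieties GRANTED the Hodge conjecture for
every complex abelian variety (the "abelian complement" in CONDITIONAL form). It is wanted, rank 9,
"NOT CLAIMED / do not staff", by `route-HodgeConjecture-ConservativityLefschetz` (live decl above) and
was wanted by `route-HodgeConjecture-RankFourFaces` until 2026-08-16T16:51Z, when that route replaced it
by the COMPLEMENT form `RankFourFaces.AbelianComplement` (stmt-HodgeConjecture-15889: HC for every
smooth projective `n`-fold that is not `A.X` for an `n`-dimensional abelian variety `A`), which implies
the present item by the case split of `RankFourFaces.closes`. This file concludes the item's LIVE decl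
by name (the default `--crux-decl` of `ledger skeleton check`); it deliberately does not import the
RankFourFaces route module, whose homonymous decl is the other item.

Refuter consensus on the item (notes g41-14/16/26/38/52, 2026-08-15): an implication between two open
statements, summit-strength as a statement (no reduction of general HC to abelian varieties is known),
honest placeholder so that `closes` reaches the Statement. A birth skeleton cannot change that; what it
can do is cut the conditional complement into ≥ 2 genuine, individually weaker, open pieces over the
tree's PROVED reduction machinery, so that the item has a registered plan and its open content is
named precisely.

## The cut — the middle-degree ladder, granted abelian varieties

Three theorems of the tree are used BY NAME in the assembly (not restated as stubs):

* `Theorems.middleReduction_proof : NoetherLefschetzOneUp.MiddleReduction` (BrosnanFangNiePearlstein2009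
  Lemma 48, proved @ ba3d26648a63): HC for all `X` and all `p` follows from the MIDDLE degree `(m,m)` of
  all smooth projective `2m`-folds;
* `NoetherLefschetzOneUp.LefschetzOneOne_holds` (Lefschetz (1,1), proved @ 44a5d6d9a7d8): level `m = 1`;
* `algebraicClasses_zero` (`N⁰H⁰ = H⁰`): level `m = 0`;
* `NoetherLefschetzOneUp.HodgeModels_holds` (proved @ 614fa71ac06a): the anti-vacuity conjunct
  `Nonempty (HodgeModel n X)` of `HodgeConjectureFor`.

Hence the OPEN content of the crux is exactly "granted HC for every abelian variety (of every
dimension), every rational `(m,m)`-class on every smooth projective `2m`-fold is algebraic, for every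
`m ≥ 2`", and the skeleton cuts it at the first open level:

* `stub_fourfoldsGrantedAbelian` — LEVEL 2: granted HC for all abelian varieties, every rational
  `(2,2)`-class on every smooth projective complex FOURFOLD is algebraic. OPEN (abelian fourfolds
  themselves are now a theorem — Markman, arXiv:2509.23403 Thm 1.1 / Cor 1.3 — so the hypothesis enters
  through abelian varieties of HIGHER dimension dominating fourfolds of abelian motivic type: products of
  curves via their Jacobians, Kummer-type and isotrivially fibred fourfolds; what is left is `(2,2)` on
  fourfolds of non-abelian type: general type, Calabi–Yau and hyperkähler fourfolds, `K3 × K3`, Fano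
  fourfolds beyond the known uniruled / cubic cases). [Deligne2000; ConteMurre1978 (uniruled fourfolds);
  Zucker1977 (cubic fourfolds); arXiv:2509.23403; Voisin2002KaehlerCounterexample]
* `stub_ladderGrantedAbelian` — THE LADDER FROM SIXFOLDS ON (conditional ladder form): for every
  `m ≥ 3`, granted HC for all abelian varieties AND the middle degrees of all smooth projective
  `2m'`-folds for every `m' < m`, every rational `(m,m)`-class on every smooth projective `2m`-fold is
  algebraic. OPEN; stated in ladder form so that it is NOT summit-equivalent on its own (it lacks the
  level-2 floor, exactly the content of stub 1; compare `Cruxes/SummitGrantedFourfolds/Lines/birth.lean`,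
  whose unconditional-ladder caveat via `X ↦ X × ℙ²`, retired stmt-HodgeConjecture-14417, is the reason
  for the ladder form). [BrosnanFangNiePearlstein2009 Lemma 48; Deligne2000; Andre1996Motifs]
* `AbelianComplement_of` (no `sorry`): from the two stubs (as name-keyed hypotheses) to the crux BY NAME —
  strong induction on the level `m` (floor `m = 0, 1` by the tree theorems, `m = 2` stub 1, `m ≥ 3`
  stub 2, the abelian hypothesis threaded through both), then `middleReduction_proof` and
  `HodgeModels_holds`.

`sorry` occurs only inside the two `stub_*` theorems.

## Honesty box

* Neither stub is the crux or the summit in costume: stub 1 says nothing above dimension 4; stub 2 has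
  no floor. BC3 probes `stub → ConservativityLefschetz.AbelianComplement` and `stub → HodgeConjecture`
  by `first | exact? | simpa using h | aesop` fail for both (registrar folder `bc/probes.lean`, quoted in
  `Lines/birth.md`). Conversely both stubs are consequences of `HodgeConjecture` (by specialisation), as
  every item of both routes is; neither is refutable short of `¬HodgeConjecture`.
* The abelian hypothesis is load-bearing in kind, not decoration: HC for abelian varieties of
  unbounded dimension is what makes varieties dominated by products of curves / abelian varieties fall
  (pull back to the product of Jacobians, split the Hodge class there by polarisability, push forward),
  at every level of the ladder.
* Disproof used: none — `Cruxes/AbelianComplement/` had no `Disproof.lean` and no workfiles when this was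
  written (`ledger crux ls stmt-HodgeConjecture-10452`: "no workfiles yet"); no `Theorems/…/Negative/`
  lemma exists for this decl; `ledger negatives --problem HodgeConjecture` (3 entries: MilnorKExponential
  SymbolLift, DerivedTorelliFermat K3 exhaustion, ELineTransport connectivity matrix) has no statement
  equal or trivially equivalent to either stub.
-/

set_option linter.dupNamespace false

namespace Summit.HodgeConjecture.HodgeConjecture.Cruxes.AbelianComplement.Birth

open Literature.AlgebraicGeometry.Motives Literature.AlgebraicGeometry.HodgeTheory
open Summit.HodgeConjecture.HodgeConjecture.Theses.NoetherLefschetzOneUp (HodgeModels_holds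
  LefschetzOneOne_holds)

/-! ## §1 Statements -/

/-- The crux's hypothesis, verbatim: the Hodge conjecture for every complex abelian variety `A`
(smooth-projectivity of `A.X` in dimension `A.dim` carried as an explicit, always-true hypothesis, as in
the item). [Deligne2000; Andre1996Motifs] -/
def AbelianHodge : Prop :=
  ∀ A : AbelianVariety ℂ, IsSmoothProjective A.dim A.X → HodgeConjectureFor A.dim A.X

/-- Level `m` of the middle-degree ladder: every rational `(m,m)`-class on every smooth projective
complex `2m`-fold is algebraic (the antecedent of `NoetherLefschetzOneUp.MiddleReduction`, one level at
a time). [BrosnanFangNiePearlstein2009, Lemma 48] -/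
def MiddleLevel (m : ℕ) : Prop :=
  ∀ ⦃X : SchemeOver ℂ⦄, IsSmoothProjective (2 * m) X → ∀ c : complexBetti X (2 * m),
    IsRationalClass c → IsOfHodgeType (2 * m) X (2 * m) m m c → c ∈ algebraicClasses X m

/-- STUB 1 statement — fourfolds granted abelian varieties: HC for all complex abelian varieties implies
that every rational `(2,2)`-class on every smooth projective complex fourfold is algebraic.
[Deligne2000; ConteMurre1978; Zucker1977; arXiv:2509.23403] -/
def FourfoldsGrantedAbelian : Prop :=
  AbelianHodge → MiddleLevel 2

/-- STUB 2 statement — the ladder from sixfolds on, granted abelian varieties (conditional ladder form):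
for `m ≥ 3`, HC for all complex abelian varieties together with the middle degrees of all smooth
projective `2m'`-folds for every `m' < m` imply the middle degree `(m,m)` of every smooth projective
`2m`-fold. [BrosnanFangNiePearlstein2009 Lemma 48; Deligne2000; Andre1996Motifs] -/
def LadderGrantedAbelian : Prop :=
  ∀ m : ℕ, 3 ≤ m → AbelianHodge → (∀ m' : ℕ, m' < m → MiddleLevel m') → MiddleLevel m

/-! ## §2 The stubs (the ONLY `sorry`s of this file) -/

/-- STUB 1 (registered): `FourfoldsGrantedAbelian`. -/
theorem stub_fourfoldsGrantedAbelian : FourfoldsGrantedAbelian := by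
  sorry

/-- STUB 2 (registered): `LadderGrantedAbelian`. -/
theorem stub_ladderGrantedAbelian : LadderGrantedAbelian := by
  sorry

/-! ### Name-keyed aliases (the skeleton audit admits a hypothesis of `AbelianComplement_of` iff the
head constant of its type has the short name of a declared stub) -/
namespace Registered

/-- Alias of `FourfoldsGrantedAbelian` keyed by the registered stub name. -/
abbrev stub_fourfoldsGrantedAbelian : Prop := FourfoldsGrantedAbelian
/-- Alias of `LadderGrantedAbelian` keyed by the registered stub name. -/
abbrev stub_ladderGrantedAbelian : Prop := LadderGrantedAbelian

end Registered

/-! ## §3 Composition (no `sorry` below this line) -/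

/-- **The two stubs imply the crux, BY NAME.** Given HC for all abelian varieties (`hAV`) and a smooth
projective `n`-fold `X`: every level of the middle-degree ladder holds, by strong induction on `m` —
`m = 0` (`algebraicClasses_zero`), `m = 1` (Lefschetz (1,1), `LefschetzOneOne_holds`), `m = 2` (stub 1
with `hAV`), `m ≥ 3` (stub 2 with `hAV` and the induction hypothesis); then BFNP's reduction to the
middle degree (`Theorems.middleReduction_proof`) gives every `(p,p)`-class on `X`, and
`HodgeModels_holds` the anti-vacuity conjunct of `HodgeConjectureFor n X`. -/
theorem AbelianComplement_of (h₁ : Registered.stub_fourfoldsGrantedAbelian)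
    (h₂ : Registered.stub_ladderGrantedAbelian) :
    Summit.HodgeConjecture.HodgeConjecture.Theses.ConservativityLefschetz.AbelianComplement := by
  unfold Summit.HodgeConjecture.HodgeConjecture.Theses.ConservativityLefschetz.AbelianComplement
  intro hAV n X hX
  -- every level of the middle-degree ladder, by strong induction on `m`
  have hmid : ∀ m : ℕ, MiddleLevel m := by
    intro m
    induction m using Nat.strong_induction_on with
    | _ m ih =>
      obtain hm | hm := Nat.lt_or_ge m 3
      · interval_cases m
        · -- level 0: `N⁰ H⁰ = H⁰`
          intro Y _ c _ _
          rw [algebraicClasses_zero]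
          exact Submodule.mem_top
        · -- level 1: Lefschetz (1,1) (tree theorem)
          exact fun Y hY c hc hpp ↦ LefschetzOneOne_holds hY c hc hpp
        · -- level 2: stub 1, granted the abelian hypothesis
          exact h₁ hAV
      · -- level ≥ 3: stub 2, granted the abelian hypothesis and all lower levels
        exact h₂ m hm hAV ih
  -- conjunct 1: Hodge models (tree theorem); conjunct 2: BFNP reduction to the middle degree (tree theorem)
  exact ⟨HodgeModels_holds hX,
    Summit.HodgeConjecture.HodgeConjecture.Theorems.middleReduction_proof
      (fun m Y hY c hc hpp ↦ hmid m hY c hc hpp) hX⟩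

/-- Wiring check: the registered stubs feed the composition as stated (definitional unfolding only). -/
example : Summit.HodgeConjecture.HodgeConjecture.Theses.ConservativityLefschetz.AbelianComplement :=
  AbelianComplement_of stub_fourfoldsGrantedAbelian stub_ladderGrantedAbelian

/-! ## §4 Plumbing sanity (proved, no `sorry`): the floor of the ladder is in the tree — levels `0` and
`1` of `MiddleLevel` hold outright, so the stubs start exactly where the theorems stop. -/

example : MiddleLevel 0 := by
  intro Y _ c _ _
  rw [algebraicClasses_zero]
  exact Submodule.mem_top

example : MiddleLevel 1 :=
  fun _ hY c hc hpp ↦ LefschetzOneOne_holds hY c hc hpp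

/-- Sanity in the other direction (informative only): each stub is a CONSEQUENCE of the summit, by
specialisation — so neither is refutable short of `¬HodgeConjecture`. -/
example (hS : _root_.HodgeConjecture) : FourfoldsGrantedAbelian :=
  fun _ _ hX c hc hpp ↦ (hS hX).2 2 c hc hpp

example (hS : _root_.HodgeConjecture) : LadderGrantedAbelian :=
  fun m _ _ _ _ hX c hc hpp ↦ (hS hX).2 m c hc hpp

end Summit.HodgeConjecture.HodgeConjecture.Cruxes.AbelianComplement.Birth
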